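import Summits.BirchSwinnertonDyer.BirchSwinnertonDyer.Theorems.ThetaPartnerAtTwoSignedControlAtTwoStubPlusHondaSystemTwo
import HarnessLib

/-!
# Sprung's Honda system AT `p = 2`, II (sub-row `a₂ = 0`): the PRIMAL Honda data over `ℚ_[2]` with the BOTTOM TRACE RELATION
# `Tr_{1/0} d_1 = −4•d_0` — the one relation of `F1Sign2.IsHondaSystemAtTwo` that the tree's HONDA⁺@2 does not display

Seat `bsd-2adic-tower-1` GEN 66, hand H2-C1 (pen GEN 40 SUMMON 20260831T155847Z): kernel theorems toward (C1)
`Summit.BirchSwinnertonDyer.Rank1Residual.F1Sign2.HondaSystemAtTwoExists` (crux `SupersingularRankZeroAtTwo`, item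
stmt-BirchSwinnertonDyer-19097). Sequel of `…SupersingularHondaSystemAtTwoDual` (I).

THE POINT. The tree already holds the primal Honda data at `2` on the sub-row `a₂ = 0` (TP2, K4 line `eulerchar`, HONDA⁺@2:
`SignedKatoOffTwo.LocalTwo.plusPointsLayer_two` — tower points `c_m` with `Λ(c_m) = ell 2 m`, inverters `σ_m`,
`d_n = 3•(c_{n+2} + σ_{n+2}•c_{n+2}) − 2•c_1 ∈ E(ℚ_{2,n})`, (TR) `Tr_{m+2/m+1} d_{m+2} = −d_m`, (NONDIV) `d_0 ∉ 2E(ℚ₂)`;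
`SignedEC.PlusLayer.plusHondaSystemTwo_padic` — (GEN) for `m ≥ 1`), in EXACTLY the `localLayerPointsOfEmb κ ι W` /
`localTraceOfEmb` currency of `IsHondaSystemAtTwo`. `IsHondaSystemAtTwo` (with `a₂ = 0`, `cneg := −d_0`) asks in addition for the
bottom relation `Tr_{1/0} c_1 = a₂•c_0 + (4 − 2a₂)•cneg`, i.e. **`Tr_{1/0} d_1 = −4•d_0`**. This file proves it for the displayed points
and repackages the primal data with it:
* §1 (`Ω`-currency, any good supersingular `ℤ₂`-model `M` with `2 ∣ a₁`, `M ⊗ ℚ̄₂ = W ⊗ ℚ̄₂`) `plusPoints_trace_one` —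
  `∑_{Stab ζ₄/Stab ζ₈} q̃ • d_1 = −(4 • c_1)`: by the exact `Δ`-twisted trace relation at `m = 2`
  (`sum_act_add_sum_act_add_eq_two_nsmul`: `Tr_{ℚ₂(ζ₈)/ℚ₂(ζ₄)}(c_3 + σc_3) + (c_1 + σc_1) = 2c_1`, and `σc_1 = c_1`), so the `Δ`-twisted
  trace of `c_3` VANISHES (`∑_{u odd} ell(ζ₈^u − 1) = ∑ ζ₈^u = 0`); `plusPoints_zero_eq_one` — `d_0 = c_1` (both `3•(c_2 + σc_2)` and `3•c_1`
  have logarithm `−6`: `ell 2 2 + σ•ell 2 2 = −2 = ell 2 1`, and `Λ` is injective on `L(2) ∩ E₁`, `eq_of_ptLogΩ_eq_two`).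
* §2 `plusGen_two_of_displayed` — (GEN) for the DISPLAYED `d` (the body of `SignedEC.PlusLayer.plusHondaSystemTwo_padic_of_ellPlus`,
  whose `∃ d` hides the witness; re-run verbatim on the displayed witness).
* §3 **`primalHondaAtTwo_padic_of_frobeniusTrace_eq_zero`** — over Mathlib's `ℚ_[2]`, every `ι`: `∃ d`, (L) ∧ (R1)
  `localTraceOfEmb κ ι W 0 1 (d 1) = −(4 • d 0)` ∧ (TR) ∧ (GEN, `m ≥ 1`) ∧ (NONDIV).
HONEST FRAMING: THEOREMS ONLY (no definition, no named fact, no instance, no `sorry`), route-independent (no `Theses` import);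
local theory at `2` on the sub-row `a₂ = 0`; closes no item; BSD is not proved by any of this.

References: [Kobayashi2003] S. Kobayashi, Invent. Math. 152 (2003), Lemma 8.9, Props. 8.11–8.12; [Sprung2012] F. Sprung, J. Number
Theory 132 (2012), Thm. 2.2 (2′) (p. 1487), Lemma 2.3; [KuriharaOtsuki2006] M. Kurihara, R. Otsuki, §1.3, Prop. 1.4, p. 557;
cell memo MEMO-imc §10.90 / REF1 §139 R3 (`Tr d₁ = a·d₀ + (4 − 2a)·ε`).
-/

set_option autoImplicit false
-- the Theorems namespace of this sub repeats the summit name by design (D-0017 nested layout)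
set_option linter.dupNamespace false

noncomputable section

open scoped Classical IntermediateField Topology NNReal NumberField
open Filter PowerSeries Finset

namespace Summit.BirchSwinnertonDyer.BirchSwinnertonDyer.Theorems.SSHondaTwo

open Field WeierstrassCurve NumberField IsDedekindDomain Literature.NumberTheory.EllipticCurves
  Literature.NumberTheory.GaloisRepresentations Literature.RingTheory.FormalGroups
  Literature.NumberTheory.EllipticCurves.ZpExtension Literature.NumberTheory.EllipticCurves.Kobayashi2003
  Literature.NumberTheory.EllipticCurves.FormalGroupChart Literature.NumberTheory.EllipticCurves.Rank1Residual
  Summit.BirchSwinnertonDyer.Rank1Residual.Additive Summit.BirchSwinnertonDyer.Rank1Residual.Additive.PadicCyclotomicTower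
  Summit.BirchSwinnertonDyer.Rank1Residual.Additive.BallEval Summit.BirchSwinnertonDyer.Rank1Residual.Additive.HondaFss
  Summit.BirchSwinnertonDyer.BirchSwinnertonDyer.Theorems.SignedKatoOffTwo.LocalAllPrimes
  Summit.BirchSwinnertonDyer.BirchSwinnertonDyer.Theorems.SignedKatoOffTwo.LocalTwo
  Summit.BirchSwinnertonDyer.BirchSwinnertonDyer.Theorems.SignedEC
  Summit.BirchSwinnertonDyer.BirchSwinnertonDyer.Theorems.SignedEC.PlusLayer

/-! ## §1 The bottom of the `ℤ₂`-tower in `Ω`-currency: `∑_{Stab ζ₄/Stab ζ₈} q̃ • d_1 = −4•c_1` and `d_0 = c_1` -/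

section Loc

variable {K : Type} [Field K] [Algebra K ℚ_[2]] {W : WeierstrassCurve K} {M : WeierstrassCurve ℤ_[2]}
  [hE : (M.map PadicInt.Coe.ringHom).IsElliptic] [hEt : (M.map PadicInt.toZMod).IsElliptic]
  (hV : genFibΩ 2 M = W.baseChange (AlgebraicClosure ℚ_[2]))

/-- **`∑_{Stab ζ₄/Stab ζ₈} q̃ • d_1 = −(4 • c_1)`** for `d_1 = 3•(c_3 + σ_3•c_3) − 2•c_1` (tower points `c_m ∈ L(m) ∩ E₁`,
`Λ(c_m) = ell 2 m`, on a good supersingular `ℤ₂`-model with `2 ∣ a₁`; `σ_m` inverters): the exact `Δ`-twisted trace relation at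
`m = 2` reads `Tr_{ℚ₂(ζ₈)/ℚ₂(ζ₄)}(c_3 + σ_3 c_3) + (c_1 + σ_3 c_1) = 2c_1` with `σ_3 c_1 = c_1`, so the twisted trace of `c_3` vanishes
(`∑_{u odd} ell(ζ₈^u − 1) = ∑ ζ₈^u = 0`) and only `−2•(2•c_1)` survives. [cite: Kobayashi2003, Lemma 8.9]
[cite: KuriharaOtsuki2006, Prop. 1.4] [cite: Sprung2012, Thm. 2.2 (2′)] -/
theorem plusPoints_trace_one [Fintype (stab 2 2 ⧸ (stab 2 (2 + 1)).subgroupOf (stab 2 2))]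
    (h₁ : M.a₁ ∈ IsLocalRing.maximalIdeal ℤ_[2])
    {c : ℕ → (genFibΩ 2 M).toAffine.Point}
    (hc : haveI := isIntegral_genFib_baseChange 2 M
      ∀ m, c m ∈ subfieldPoints (genFibΩ 2 M) (layer 2 m).toSubfield coeffs_mem_layer ∧
      c m ∈ kernel (Valued.v (R := PadicAlgCl 2)) (genFibΩ 2 M) ∧ ptLogΩ 2 M (c m) = ell 2 m)
    (σ : ℕ → Field.absoluteGaloisGroup ℚ_[2]) :
    ∑ q : stab 2 2 ⧸ (stab 2 (2 + 1)).subgroupOf (stab 2 2),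
        ((q.out : stab 2 2) : Field.absoluteGaloisGroup ℚ_[2]) •
          (3 • (toLoc hV (c 3) + σ 3 • toLoc hV (c 3)) - 2 • toLoc hV (c 1)) =
      -(4 • toLoc hV (c 1)) := by
  haveI hintΩ := isIntegral_genFib_baseChange 2 M
  set e := toLoc hV with he
  set act : Field.absoluteGaloisGroup ℚ_[2] → (genFibΩ 2 M).toAffine.Point → (genFibΩ 2 M).toAffine.Point :=
    fun τ Q => e.symm (τ • e Q) with hact_def
  have hact0 : ∀ τ, act τ 0 = 0 := fun τ => act_zero hV τ
  have hact : ∀ τ (x y : PadicAlgCl 2) (h : (genFibΩ 2 M).toAffine.Nonsingular x y),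
      ∃ h', act τ (Affine.Point.some x y h) = Affine.Point.some (τ • x) (τ • y) h' := fun τ x y h => act_some hV τ x y h
  have he_act : ∀ τ Q, e (act τ Q) = τ • e Q := fun τ Q => by simp only [hact_def, AddEquiv.apply_symm_apply]
  -- the exact twisted trace relation at `m = 2`, transported along `e`
  have hrel := sum_act_add_sum_act_add_eq_two_nsmul h₁ act hact0 hact (σ 3) (m := 2) (by omega)
    (c := c 3) (c' := c 1) (c₁ := c 1) (hc (2 + 1)).1 (hc (2 + 1)).2.1 (hc (2 + 1)).2.2
    (by simpa using (hc 1).1) (hc 1).2.1 (by simpa using (hc 1).2.2) (hc 1).1 (hc 1).2.1 (hc 1).2.2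
  have hrel' := congrArg e hrel
  simp only [map_add, map_sum, map_nsmul, he_act] at hrel'
  -- `σ_3` and the representatives fix `c_1`
  have hσ1 : σ 3 • e (c 1) = e (c 1) := smul_toLoc_one_eq hV hc _
  have hq1 : ∀ q : stab 2 2 ⧸ (stab 2 (2 + 1)).subgroupOf (stab 2 2),
      ((q.out : stab 2 2) : Field.absoluteGaloisGroup ℚ_[2]) • e (c 1) = e (c 1) := fun q => smul_toLoc_one_eq hV hc _
  rw [hσ1] at hrel'
  have hS : (∑ q : stab 2 2 ⧸ (stab 2 (2 + 1)).subgroupOf (stab 2 2),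
        ((q.out : stab 2 2) : Field.absoluteGaloisGroup ℚ_[2]) • e (c 3)) +
      ∑ q : stab 2 2 ⧸ (stab 2 (2 + 1)).subgroupOf (stab 2 2),
        ((q.out : stab 2 2) : Field.absoluteGaloisGroup ℚ_[2]) • (σ 3 • e (c 3)) = 0 := by
    have h2 : e (c 1) + e (c 1) = 2 • e (c 1) := (two_nsmul _).symm
    rw [h2] at hrel'
    exact add_right_cancel (b := 2 • e (c 1)) (by rw [zero_add]; exact hrel')
  have hsum : ∑ q : stab 2 2 ⧸ (stab 2 (2 + 1)).subgroupOf (stab 2 2),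
      ((q.out : stab 2 2) : Field.absoluteGaloisGroup ℚ_[2]) •
        (3 • (e (c 3) + σ 3 • e (c 3)) - 2 • e (c 1)) =
      3 • ((∑ q : stab 2 2 ⧸ (stab 2 (2 + 1)).subgroupOf (stab 2 2),
          ((q.out : stab 2 2) : Field.absoluteGaloisGroup ℚ_[2]) • e (c 3)) +
        ∑ q : stab 2 2 ⧸ (stab 2 (2 + 1)).subgroupOf (stab 2 2),
          ((q.out : stab 2 2) : Field.absoluteGaloisGroup ℚ_[2]) • (σ 3 • e (c 3))) -
      2 • (2 • e (c 1)) := by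
    simp_rw [smul_sub, smul_comm _ (3 : ℕ), smul_comm _ (2 : ℕ), smul_add, hq1]
    rw [Finset.sum_sub_distrib, Finset.sum_const, Finset.card_univ, card_stab_quot_two (by omega),
      Finset.sum_add_distrib, ← Finset.smul_sum, ← Finset.smul_sum]
  rw [hsum, hS, smul_zero, zero_sub, ← mul_nsmul]

/-- **`d_0 = c_1`**: `3•(c_2 + σ_2•c_2) − 2•c_1 = c_1`, because `c_2 + σ_2•c_2 = c_1` — both lie in `L(2) ∩ E₁` and have the same
logarithm `ell 2 2 + σ_2•ell 2 2 = −2 = ell 2 1` (`Λ` is injective on `L(2) ∩ E₁` on a good supersingular model with `2 ∣ a₁`).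
[cite: Kobayashi2003, Prop. 8.7, Lemma 8.9] [cite: KuriharaOtsuki2006, §1.3] -/
theorem plusPoints_zero_eq_one (h₁ : M.a₁ ∈ IsLocalRing.maximalIdeal ℤ_[2])
    {c : ℕ → (genFibΩ 2 M).toAffine.Point}
    (hc : haveI := isIntegral_genFib_baseChange 2 M
      ∀ m, c m ∈ subfieldPoints (genFibΩ 2 M) (layer 2 m).toSubfield coeffs_mem_layer ∧
      c m ∈ kernel (Valued.v (R := PadicAlgCl 2)) (genFibΩ 2 M) ∧ ptLogΩ 2 M (c m) = ell 2 m)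
    {σ : ℕ → Field.absoluteGaloisGroup ℚ_[2]} (hσ : ∀ m, 1 ≤ m → σ m • zeta 2 m = (zeta 2 m)⁻¹) :
    3 • (toLoc hV (c 2) + σ 2 • toLoc hV (c 2)) - 2 • toLoc hV (c 1) = toLoc hV (c 1) := by
  haveI hintΩ := isIntegral_genFib_baseChange 2 M
  set e := toLoc hV with he
  set act : Field.absoluteGaloisGroup ℚ_[2] → (genFibΩ 2 M).toAffine.Point → (genFibΩ 2 M).toAffine.Point :=
    fun τ Q => e.symm (τ • e Q) with hact_def
  have hact0 : ∀ τ, act τ 0 = 0 := fun τ => act_zero hV τ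
  have hact : ∀ τ (x y : PadicAlgCl 2) (h : (genFibΩ 2 M).toAffine.Nonsingular x y),
      ∃ h', act τ (Affine.Point.some x y h) = Affine.Point.some (τ • x) (τ • y) h' := fun τ x y h => act_some hV τ x y h
  have he_act : ∀ τ Q, e (act τ Q) = τ • e Q := fun τ Q => by simp only [hact_def, AddEquiv.apply_symm_apply]
  have hσcL : act (σ 2) (c 2) ∈ subfieldPoints (genFibΩ 2 M) (layer 2 2).toSubfield coeffs_mem_layer :=
    act_mem_subfieldPoints act hact0 hact _ (hc 2).1
  have hσck : act (σ 2) (c 2) ∈ kernel (Valued.v (R := PadicAlgCl 2)) (genFibΩ 2 M) :=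
    act_mem_kernel act hact0 hact _ (hc 2).2.1
  have hsL : c 2 + act (σ 2) (c 2) ∈ subfieldPoints (genFibΩ 2 M) (layer 2 2).toSubfield coeffs_mem_layer :=
    (subfieldPoints _ _ _).add_mem (hc 2).1 hσcL
  have hsk : c 2 + act (σ 2) (c 2) ∈ kernel (Valued.v (R := PadicAlgCl 2)) (genFibΩ 2 M) :=
    (kernel (Valued.v (R := PadicAlgCl 2)) (genFibΩ 2 M)).add_mem (hc 2).2.1 hσck
  have hc1L : c 1 ∈ subfieldPoints (genFibΩ 2 M) (layer 2 2).toSubfield coeffs_mem_layer :=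
    subfieldPoints_layer_mono (by omega) (hc 1).1
  have hlog : ptLogΩ 2 M (c 2 + act (σ 2) (c 2)) = ptLogΩ 2 M (c 1) := by
    haveI := isIntegral_curveK 2 (LayerField 2 2) M
    rw [ptLogΩ_add (m := 2) (hc 2).1 hσcL (hc 2).2.1 hσck,
      ptLogΩ_act act hact0 hact _ (norm_zCoord_lt_one_of_mem_kernel (hc 2).2.1), (hc 2).2.2, (hc 1).2.2,
      ell_two_two_add_smul (hσ 2 (by omega)), ell_two_one]
  have heq : c 2 + act (σ 2) (c 2) = c 1 := eq_of_ptLogΩ_eq_two h₁ (m := 2) hsL hsk hc1L (hc 1).2.1 hlog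
  have heq' := congrArg e heq
  rw [map_add, he_act] at heq'
  rw [heq', show (3 : ℕ) = 2 + 1 from rfl, add_nsmul, one_nsmul, add_sub_cancel_left]

end Loc

/-! ## §2 (GEN) for the DISPLAYED plus points (the body of `SignedEC.PlusLayer.plusHondaSystemTwo_padic_of_ellPlus`) -/

/-- **(GEN) for K3's displayed family** `d_n = 3•(c_{n+2} + σ_{n+2}•c_{n+2}) − 2•c_1` of `plusPointsLayer_two` (`W/ℚ` globally minimal,
`GoodSS W 2`, `a₂(W) = 0`, cyclotomic `κ`, any `ι`): for `m ≥ 1` every `P ∈ E(ℚ_{2,m}·ℚ₂)` is `B + P' + 2•R` with `B ∈ ℤ[Γ·d_m]`,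
`P' ∈ E(ℚ_{2,m−1}·ℚ₂)`, `R ∈ E(ℚ_{2,m}·ℚ₂)`. Verbatim the body of `SignedEC.PlusLayer.plusHondaSystemTwo_padic_of_ellPlus` (whose
conclusion hides the witness behind `∃ d`), run on the displayed witness. [cite: Kobayashi2003, Props. 8.11–8.12]
[cite: Sprung2012, Thm. 2.2] -/
theorem plusGen_two_of_displayed (W : WeierstrassCurve ℚ) [W.IsElliptic] [W.IsGloballyMinimal]
    (hss : GoodSS W 2) (ha : W.frobeniusTrace 2 = 0) (κ : ZpExtension ℚ 2) (hκ : κ.IsCyclotomic)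
    (ι : AlgebraicClosure ℚ →ₐ[ℚ] AlgebraicClosure ℚ_[2])
    {c : ℕ → localPoints W ℚ_[2]} {σ : ℕ → absoluteGaloisGroup ℚ_[2]} {d : ℕ → localPoints W ℚ_[2]}
    (hcΩ : haveI := isIntegral_genFib_baseChange 2 ((integralModelInt W).map (Int.castRingHom ℤ_[2]))
      ∀ m, (toLoc ((genFibΩ_eq_baseChange ((integralModelInt W).map (Int.castRingHom ℤ_[2]))).trans
            (baseChange_twoAdicModel W))).symm (c m) ∈
          subfieldPoints (genFibΩ 2 ((integralModelInt W).map (Int.castRingHom ℤ_[2]))) (layer 2 m).toSubfield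
            coeffs_mem_layer ∧
        (toLoc ((genFibΩ_eq_baseChange ((integralModelInt W).map (Int.castRingHom ℤ_[2]))).trans
            (baseChange_twoAdicModel W))).symm (c m) ∈
          kernel (Valued.v (R := PadicAlgCl 2)) (genFibΩ 2 ((integralModelInt W).map (Int.castRingHom ℤ_[2]))) ∧
        ptLogΩ 2 ((integralModelInt W).map (Int.castRingHom ℤ_[2]))
          ((toLoc ((genFibΩ_eq_baseChange ((integralModelInt W).map (Int.castRingHom ℤ_[2]))).trans
            (baseChange_twoAdicModel W))).symm (c m)) = ell 2 m)
    (hcstab : ∀ m, ∀ τ ∈ stab 2 m, τ • c m = c m)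
    (hσ : ∀ m, 1 ≤ m → σ m • zeta 2 m = (zeta 2 m)⁻¹)
    (hd : ∀ n, d n = 3 • (c (n + 2) + σ (n + 2) • c (n + 2)) - 2 • c 1)
    {m : ℕ} (hm : 1 ≤ m) {Q : localPoints W ℚ_[2]} (hQ : Q ∈ localLayerPointsOfEmb κ ι W m) :
    ∃ B ∈ AddSubgroup.closure (Set.range fun τ : absoluteGaloisGroup ℚ_[2] ↦ τ • d m),
      ∃ P' ∈ localLayerPointsOfEmb κ ι W (m - 1), ∃ R ∈ localLayerPointsOfEmb κ ι W m, Q = B + P' + 2 • R := by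
  obtain ⟨m', rfl⟩ := Nat.exists_eq_add_of_le' hm
  -- the `2`-adic model and its identification with `W ⊗ ℚ̄₂`
  set M : WeierstrassCurve ℤ_[2] := (integralModelInt W).map (Int.castRingHom ℤ_[2]) with hM
  haveI := isElliptic_coe_twoAdicModel W
  haveI := isElliptic_toZMod_twoAdicModel W hss.1
  haveI hintΩ := isIntegral_genFib_baseChange 2 M
  set hV := (genFibΩ_eq_baseChange M).trans (baseChange_twoAdicModel W) with hVdef
  have htr : Literature.NumberTheory.EllipticCurves.HasseManin.tr (M.map PadicInt.toZMod) = 0 := by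
    rw [hM, tr_twoAdicModel W hss.1, ha]
  have h₁ := a₁_twoAdicModel_mem W hss
  have htors : ∀ Q ∈ subfieldPoints (genFibΩ 2 M) (layer 2 (m' + 1 + 2)).toSubfield coeffs_mem_layer,
      ∀ k : ℕ, 2 ^ k • Q = 0 → Q = 0 :=
    fun Q hQ k hk ↦ eq_zero_of_two_pow_smul_eq_zero_of_mem_subfieldPoints_layer M h₁ _ hQ hk
  set act : absoluteGaloisGroup ℚ_[2] → (genFibΩ 2 M).toAffine.Point → (genFibΩ 2 M).toAffine.Point :=
    fun τ P ↦ (toLoc hV).symm (τ • toLoc hV P) with hact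
  -- the plus Honda point `e = c̃ + σ c̃` at level `m' + 3`
  obtain ⟨hcL, hck, hcℓ⟩ := hcΩ (m' + 3)
  set ct := (toLoc hV).symm (c (m' + 3)) with hct
  have hσ3 := hσ (m' + 3) (by omega)
  set e := ct + act (σ (m' + 3)) ct with he
  have hacte : act (σ (m' + 3)) ct = (toLoc hV).symm (σ (m' + 3) • c (m' + 3)) := by
    rw [hact]; simp only [hct, AddEquiv.apply_symm_apply]
  have he_toLoc : toLoc hV e = c (m' + 3) + σ (m' + 3) • c (m' + 3) := by
    rw [he, map_add, hacte, hct, AddEquiv.apply_symm_apply, AddEquiv.apply_symm_apply]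
  have heLayer : toLoc hV e ∈ localLayerPointsOfEmb κ ι W (m' + 1) := by
    rw [he_toLoc]
    exact add_smul_mem_localLayerPointsOfEmb_two_stab W ι hκ hσ3 (hcstab (m' + 3))
  have heL : e ∈ subfieldPoints (genFibΩ 2 M) (ℚ_[2]⟮zeta 2 (m' + 1 + 2) + (zeta 2 (m' + 1 + 2))⁻¹ - 2⟯).toSubfield
      (PlusTower.coeffs_mem_adjoin M _) := by
    have h := (mem_localLayerPointsOfEmb_two_iff_mem_subfieldPoints_adjoin_v hV ι hκ (m' + 1) (toLoc hV e)).mp heLayer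
    rwa [AddEquiv.symm_apply_apply] at h
  have hactL : act (σ (m' + 3)) ct ∈ subfieldPoints (genFibΩ 2 M) (layer 2 (m' + 3)).toSubfield coeffs_mem_layer :=
    act_mem_subfieldPoints act (act_zero hV) (act_some hV) _ hcL
  have hactk : act (σ (m' + 3)) ct ∈ kernel (Valued.v (R := PadicAlgCl 2)) (genFibΩ 2 M) :=
    act_mem_kernel act (act_zero hV) (act_some hV) _ hck
  have hek : e ∈ kernel (Valued.v (R := PadicAlgCl 2)) (genFibΩ 2 M) :=
    (kernel (Valued.v (R := PadicAlgCl 2)) (genFibΩ 2 M)).add_mem hck hactk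
  have heℓ : ptLogΩ 2 M e - (zeta 2 (m' + 1 + 2) + (zeta 2 (m' + 1 + 2))⁻¹ - 2) ∈
      ℚ_[2]⟮zeta 2 (m' + 1 + 1) + (zeta 2 (m' + 1 + 1))⁻¹ - 2⟯ := by
    haveI := isIntegral_curveK 2 (LayerField 2 (m' + 3)) M
    rw [he, ptLogΩ_add (m := m' + 3) hcL hactL hck hactk,
      ptLogΩ_act act (act_zero hV) (act_some hV) _ (norm_zCoord_lt_one_of_mem_kernel hck), hcℓ]
    exact ell_add_smul_ell_sub_v_mem_adjoin_v m' hσ3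
  -- `3 • Q` lies in the image of `E₁`
  have hQlayer : (toLoc hV).symm Q ∈ subfieldPoints (genFibΩ 2 M) (layer 2 (m' + 3)).toSubfield coeffs_mem_layer := by
    obtain ⟨τ₀, -, hτ₀⟩ := exists_inverter_mem_localLayerSubgroupOfEmb_two ι hκ (m' + 1)
    exact (forall_smul_eq_iff_mem_subfieldPoints hV (m' + 3) Q).mp
      ((mem_localLayerPointsOfEmb_two_iff_stab W ι hκ hτ₀ Q).mp hQ).1
  have h3card : Nat.card (M.map PadicInt.toZMod).toAffine.Point = 3 := by
    rw [natCard_point_eq_of_tr_eq_zero M htr]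
  have h3Qk : (toLoc hV).symm ((3 : ℕ) • Q) ∈ kernel (Valued.v (R := PadicAlgCl 2)) (genFibΩ 2 M) := by
    have h : Nat.card (M.map PadicInt.toZMod).toAffine.Point • (toLoc hV).symm Q ∈
        kernel (Valued.v (R := PadicAlgCl 2)) (genFibΩ 2 M) :=
      card_smul_mem_kernel_of_mem_subfieldPoints M hQlayer
    rw [h3card, ← map_nsmul] at h
    exact @h
  have h3Qn : toLoc hV ((toLoc hV).symm ((3 : ℕ) • Q)) ∈ localLayerPointsOfEmb κ ι W (m' + 1) := by
    rw [AddEquiv.apply_symm_apply]; exact AddSubgroup.nsmul_mem _ hQ 3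
  -- (GEN) for `3 • Q` with generator `c + σ c`
  obtain ⟨B, hB, P', hP', R, hR, hEq⟩ :=
    plusGen_kernel_two hV ι hκ htr (n := m' + 1) (by omega) htors heL hek heℓ h3Qk h3Qn
  rw [AddEquiv.apply_symm_apply] at hEq
  rw [he_toLoc] at hB
  -- generator change `c + σ c ↦ d = 3 • (c + σ c) − 2 • c 1`, then odd saturation
  have hc1 : c 1 ∈ localLayerPointsOfEmb κ ι W (m' + 1 - 1) := by
    refine localLayerPointsOfEmb_mono κ ι W (Nat.zero_le _) ((mem_localLayerPointsOfEmb_zero_iff κ ι W _).mpr fun τ ↦ ?_)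
    exact hcstab 1 τ (by rw [stab_two_one]; exact Subgroup.mem_top τ)
  have hedc : 3 • (c (m' + 3) + σ (m' + 3) • c (m' + 3)) = d (m' + 1) + 2 • c 1 := by
    rw [hd (m' + 1)]; abel
  have hgen3 := plusGen_of_plusGen_generator_change (G := absoluteGaloisGroup ℚ_[2])
    (H := localLayerPointsOfEmb κ ι W (m' + 1)) (H' := localLayerPointsOfEmb κ ι W (m' + 1 - 1))
    (fun g _ hx ↦ Sprung2012.smul_mem_localLayerPointsOfEmb κ ι W _ g hx) hedc hc1 (AddSubgroup.nsmul_mem _ hQ 3)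
    ⟨B, hB, P', hP', R, hR, hEq⟩
  exact plusGen_of_plusGen_odd_nsmul hQ (by decide : Odd 3) hgen3

/-! ## §3 The primal Honda data at `2` over `ℚ_[2]` (sub-row `a₂ = 0`), WITH the bottom trace relation -/

/-- **PRIMAL Honda data at `2` over Mathlib's `ℚ_[2]`, every `ι`, sub-row `a₂ = 0`, with the bottom relation.** For `W/ℚ` globally
minimal with `GoodSS W 2`, `a₂(W) = 0`, the cyclotomic `κ` and any `ι : ℚ̄ → ℚ̄₂`, there is `d : ℕ → E(ℚ̄₂)` with
(L) `d m ∈ E(ℚ_{2,m}·ℚ₂)`, **(R1) `Tr_{1/0} d_1 = −(4 • d_0)`**, (TR) `Tr_{m+2/m+1} d_{m+2} = −d_m`, (GEN) for `m ≥ 1`, and (NONDIV)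
`d_0 ∉ 2E(ℚ₂)` — K3's displayed family (`plusPointsLayer_two`), (R1) by §1 through the w2 dictionary
`localTraceOfEmb_two_eq_sum_stab`, (GEN) by §2. [cite: Kobayashi2003, Lemma 8.9, Props. 8.11–8.12]
[cite: Sprung2012, Thm. 2.2 (2′) (p. 1487)] [cite: KuriharaOtsuki2006, p. 557] -/
theorem primalHondaAtTwo_padic_of_frobeniusTrace_eq_zero (W : WeierstrassCurve ℚ) [W.IsElliptic] [W.IsGloballyMinimal]
    (hss : GoodSS W 2) (ha : W.frobeniusTrace 2 = 0) (κ : ZpExtension ℚ 2) (hκ : κ.IsCyclotomic)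
    (ι : AlgebraicClosure ℚ →ₐ[ℚ] AlgebraicClosure ℚ_[2]) :
    ∃ d : ℕ → localPoints W ℚ_[2],
      (∀ m, d m ∈ localLayerPointsOfEmb κ ι W m) ∧
      localTraceOfEmb κ ι W 0 1 (d 1) = -(4 • d 0) ∧
      (∀ m, localTraceOfEmb κ ι W (m + 1) (m + 2) (d (m + 2)) = -d m) ∧
      (∀ m : ℕ, 1 ≤ m → ∀ P ∈ localLayerPointsOfEmb κ ι W m,
        ∃ B ∈ AddSubgroup.closure (Set.range fun σ : absoluteGaloisGroup ℚ_[2] ↦ σ • d m),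
          ∃ P' ∈ localLayerPointsOfEmb κ ι W (m - 1), ∃ R ∈ localLayerPointsOfEmb κ ι W m, P = B + P' + 2 • R) ∧
      (∀ b ∈ localLayerPointsOfEmb κ ι W 0, d 0 ≠ 2 • b) := by
  haveI hFt : ∀ m, Fintype (stab 2 m ⧸ (stab 2 (m + 1)).subgroupOf (stab 2 m)) := fun m =>
    haveI := finite_stab_quot m; Fintype.ofFinite _
  obtain ⟨c, σ, d, hcΩ, hcstab, hσ, hd, hL, hTR, hND⟩ := plusPointsLayer_two W hss ha κ hκ ι
  refine ⟨d, hL, ?_, hTR, fun m hm P hP ↦ plusGen_two_of_displayed W hss ha κ hκ ι hcΩ hcstab hσ hd hm hP, hND⟩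
  -- (R1) through the dictionary `Tr_{1/0} = ∑_{Stab ζ₄/Stab ζ₈}`
  set M : WeierstrassCurve ℤ_[2] := (integralModelInt W).map (Int.castRingHom ℤ_[2]) with hM
  haveI := isElliptic_coe_twoAdicModel W
  haveI := isElliptic_toZMod_twoAdicModel W hss.1
  haveI hintΩ := isIntegral_genFib_baseChange 2 M
  set hV := (genFibΩ_eq_baseChange M).trans (baseChange_twoAdicModel W) with hVdef
  have h₁ := a₁_twoAdicModel_mem W hss
  have key := plusPoints_trace_one hV h₁ (c := fun m ↦ (toLoc hV).symm (c m)) hcΩ σ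
  have key0 := plusPoints_zero_eq_one hV h₁ (c := fun m ↦ (toLoc hV).symm (c m)) hcΩ hσ
  simp only [AddEquiv.apply_symm_apply] at key key0
  rw [localTraceOfEmb_two_eq_sum_stab ι W hκ (by omega : 0 ≤ 1) (hL 1), hd 1, hd 0, key0]
  convert key using 2

end Summit.BirchSwinnertonDyer.BirchSwinnertonDyer.Theorems.SSHondaTwo

end
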